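import Literature.NumberTheory.GaloisRepresentations.LocalCorInjective
import Literature.NumberTheory.GaloisRepresentations.LocalGlobalCohomologyFiniteProofs
import Literature.NumberTheory.GaloisRepresentations.TateH2VanishingCorestriction
import HarnessLib

/-!
# Tate's local theorem, step "`Br_p(K) = ℤ/p`": among `p + 1` locally constant `p`-torsion
# `2`-cocycles on `Γ_K` two are equivalent (Serre, Durham 1977, §6.5 (b))

Sibling proof file of `TateProjectiveLifting.lean` (theorems only).  For a non-archimedean local
field `K` of characteristic `0` containing a primitive `p`-th root of unity `ζ`, Serre §6.5 (b)
uses *"`Br_p(K) = ℤ/pℤ`"*, i.e. `|H²(G_K, ℤ/p)| = |H²(G_K, μ_p)| = p`.  The tree proves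
`|H²(Gal(K̄/E), μ_n)| = n` for every finite `E ⊆ K̄` (`natCard_two_mu_eq`,
`LocalCorInjective.lean`, from the unramified Brauer classes of Serre, *Corps locaux* XIII §3);
with `E = K` (`galFixing K ⊥ = Γ_K`, `resHEquivOfTop`) and the identification
`ℤ/p ≅ μ_p`, `k ↦ ζ^k`, of TRIVIAL `Γ_K`-modules (`exists_addMonoidHom_zmod_mu_injective`,
`mu_apply_eq_self_of_isPrimitiveRoot`, `LocalGlobalCohomologyFiniteProofs.lean`) we derive the
cochain-level pigeonhole statement consumed by
`twoCocycle_addCircle_prime_split_of_pigeonhole_of_torsion`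
(`TateH2VanishingCharacterCriterion.lean`):

* `twoCocycle_addCircle_pigeonhole_of_isPrimitiveRoot` — **among any `p + 1` locally constant
  `p`-torsion `2`-cocycles `Γ_K × Γ_K → ℚ/ℤ` (trivial action), two differ by the coboundary of a
  locally constant `p`-torsion cochain.**  Proof: send a `p`-torsion cocycle `f` (values in
  `(1/p)ℤ/ℤ ≅ ℤ/p ≅ μ_p(K̄)`) to the class of the `μ_p`-valued continuous cocycle it defines;
  `H²(Γ_K, μ_p)` has `p` elements, so two of the `p + 1` classes agree, and a continuous
  `μ_p`-valued cochain bounding the difference is read back in `(1/p)ℤ/ℤ`.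

## References

* J.-P. Serre, *Modular forms of weight one and Galois representations*, in: Algebraic Number
  Fields (Durham 1975), Academic Press 1977, §6.5 (b). [`SerreDurham1977`]
* J.-P. Serre, *Corps locaux* (1968), XIII §3 (`Br(K)` of a local field). [`SerreLocalFields1979`]
-/

noncomputable section

open CategoryTheory Function Field

namespace Literature.NumberTheory.GaloisRepresentations

open _root_.TopRep _root_.ContRepresentation _root_.ContinuousCohomology DiscreteGaloisModule
open LocalWeilDatum

section Pigeonhole

variable (F : Type) [Field F] [ValuativeRel F] [TopologicalSpace F] [IsNonarchimedeanLocalField F]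
  [CharZero F]

/-- **`|H²(Γ_K, μ_p)| = p`** for a non-archimedean local field `K` of characteristic `0`
(`natCard_two_mu_eq` for `E = K`, transported along `Gal(K̄/K) = Γ_K`).
[cite: SerreLocalFields1979, XIII §3] -/
theorem natCard_two_mu_absoluteGaloisGroup_eq (n : ℕ) [NeZero n] :
    Nat.card (continuousCohomology 2 (mu F n).toTopRep) = n := by
  have hbot : ∀ g : absoluteGaloisGroup F,
      g ∈ galFixing F (⊥ : IntermediateField F (AlgebraicClosure F)) := fun g => by
    rw [galFixing_bot]
    trivial
  let eT := resHEquivOfTop (mu F n) (galFixing F (⊥ : IntermediateField F (AlgebraicClosure F)))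
    hbot 2
  exact (Nat.card_congr eT.toEquiv).trans (natCard_two_mu_eq F ⊥ n)

/-- **Serre §6.5 (b), "`Br_p(K) = ℤ/pℤ`", cochain form.**  Let `K` be a non-archimedean local
field of characteristic `0` containing a primitive `p`-th root of unity, `p` prime.  Among any
`p + 1` locally constant `p`-torsion `2`-cocycles `Γ_K × Γ_K → ℚ/ℤ` (trivial action) two differ
by the coboundary of a locally constant `p`-torsion cochain: their classes live in
`H²(Γ_K, μ_p) ≅ H²(Γ_K, (1/p)ℤ/ℤ)` (`ℤ/p ≅ μ_p` as trivial `Γ_K`-modules since `μ_p ⊆ K`), a group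
of order `p`. [cite: SerreDurham1977, §6.5 (b)] [cite: SerreLocalFields1979, XIII §3] -/
theorem twoCocycle_addCircle_pigeonhole_of_isPrimitiveRoot {p : ℕ} (hp : p.Prime) {ζ : F}
    (hζ : IsPrimitiveRoot ζ p)
    (f : Fin (p + 1) → absoluteGaloisGroup F → absoluteGaloisGroup F → AddCircle (1 : ℚ))
    (hf : ∀ i, IsLocallyConstant (Function.uncurry (f i)))
    (hcoc : ∀ i σ τ υ, f i σ τ + f i (σ * τ) υ = f i τ υ + f i σ (τ * υ))
    (hpf : ∀ i σ τ, p • f i σ τ = 0) :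
    ∃ i j, i ≠ j ∧ ∃ β : absoluteGaloisGroup F → AddCircle (1 : ℚ), IsLocallyConstant β ∧
      (∀ σ, p • β σ = 0) ∧ ∀ σ τ, f i σ τ - f j σ τ = β σ + β τ - β (σ * τ) := by
  classical
  haveI : NeZero p := ⟨hp.ne_zero⟩
  haveI : Fact p.Prime := ⟨hp⟩
  -- `|H²(Γ_K, μ_p)| = p`, in particular it is finite
  set X := (mu F p).toTopRep with hX_def
  have hcard : Nat.card (continuousCohomology 2 X) = p := natCard_two_mu_absoluteGaloisGroup_eq F p
  haveI : Finite (continuousCohomology 2 X) := Nat.finite_of_card_ne_zero (by rw [hcard]; exact hp.ne_zero)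
  -- `Γ_K` acts trivially on `μ_p`
  have htriv : ∀ (σ : absoluteGaloisGroup F) (z : MuCarrier F p), X.ρ σ z = z := fun σ z =>
    mu_apply_eq_self_of_isPrimitiveRoot F hζ σ z
  -- `ℤ/p ≅ μ_p(K̄)` (`k ↦ ζ^k`), a bijection since both have `p` elements
  obtain ⟨ι, hι⟩ := exists_addMonoidHom_zmod_mu_injective F hζ (n := p)
  have hcardMu : Nat.card (MuCarrier F p) = p := by
    have hζ' : IsPrimitiveRoot (algebraMap F (AlgebraicClosure F) ζ) p :=
      hζ.map_of_injective (algebraMap F (AlgebraicClosure F)).injective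
    change Nat.card (rootsOfUnity p (AlgebraicClosure F)) = p
    exact hζ'.card_rootsOfUnity
  haveI : Finite (MuCarrier F p) := Nat.finite_of_card_ne_zero (by rw [hcardMu]; exact hp.ne_zero)
  have hιbij : Bijective ι := hι.bijective_of_nat_card_le (by rw [hcardMu, Nat.card_zmod])
  set ιe : ZMod p ≃+ MuCarrier F p := AddEquiv.ofBijective ι hιbij with hιe_def
  have hιe : ∀ k, ιe k = ι k := fun k => rfl
  -- `(1/p)ℤ/ℤ ≅ ℤ/p`
  obtain ⟨e, he_inj, -, he_surj⟩ := zmod_exists_addMonoidHom_addCircle hp.pos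
  have hpre : ∀ x : AddCircle (1 : ℚ), ∃ k : ZMod p, p • x = 0 → e k = x := fun x => by
    by_cases hx : p • x = 0
    · obtain ⟨k, hk⟩ := he_surj x hx
      exact ⟨k, fun _ => hk⟩
    · exact ⟨0, fun h => absurd h hx⟩
  choose ψ hψ using hpre
  have hep : ∀ k : ZMod p, p • e k = 0 := fun k => by
    rw [← map_nsmul, nsmul_eq_mul, ZMod.natCast_self, zero_mul, map_zero]
  -- the `μ_p`-valued continuous cocycle of a `p`-torsion locally constant cocycle
  have hadd : ∀ {a b c d : AddCircle (1 : ℚ)}, p • a = 0 → p • b = 0 → p • c = 0 → p • d = 0 →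
      a + b = c + d → ψ a + ψ b = ψ c + ψ d := by
    intro a b c d ha hb hc hd h
    apply he_inj
    rw [map_add, map_add, hψ a ha, hψ b hb, hψ c hc, hψ d hd, h]
  let toMu : Fin (p + 1) → C(absoluteGaloisGroup F × absoluteGaloisGroup F, MuCarrier F p) := fun i =>
    ⟨ι ∘ ψ ∘ Function.uncurry (f i), ((hf i).comp (ι ∘ ψ)).continuous⟩
  have htoMu : ∀ i σ τ, toMu i (σ, τ) = ι (ψ (f i σ τ)) := fun i σ τ => rfl
  have hmem : ∀ i, toMu i ∈ contTwoCocycles X := by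
    intro i
    rw [mem_contTwoCocycles_iff]
    intro σ τ υ
    rw [htriv, htoMu, htoMu, htoMu, htoMu, ← map_add, ← map_add]
    refine congrArg ι (hadd (hpf i τ υ) (hpf i σ (τ * υ)) (hpf i (σ * τ) υ) (hpf i σ τ) ?_)
    rw [add_comm (f i (σ * τ) υ), hcoc]
  let γ : Fin (p + 1) → contTwoCocycles X := fun i => ⟨toMu i, hmem i⟩
  let cl : Fin (p + 1) → continuousCohomology 2 X := fun i => twoCocycleClass X (γ i)
  -- pigeonhole: `cl` is not injective
  have hnot : ¬ Injective cl := fun hinj => by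
    have h := Nat.card_le_card_of_injective cl hinj
    rw [hcard, Nat.card_eq_fintype_card, Fintype.card_fin] at h
    omega
  obtain ⟨i, j, hij_eq, hij⟩ := Function.not_injective_iff.1 hnot
  refine ⟨i, j, hij, ?_⟩
  -- a continuous `μ_p`-valued cochain bounding the difference
  have hzero : twoCocycleClass X (γ i - γ j) = 0 := by
    rw [twoCocycleClass_sub]
    exact sub_eq_zero.2 hij_eq
  obtain ⟨b, hb⟩ := (twoCocycleClass_eq_zero_iff X (γ i - γ j)).1 hzero
  have hb_lc : IsLocallyConstant (b : absoluteGaloisGroup F → MuCarrier F p) :=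
    (IsLocallyConstant.iff_continuous _).2 b.continuous
  -- read it in `(1/p)ℤ/ℤ ⊆ ℚ/ℤ`
  let Λ : MuCarrier F p →+ AddCircle (1 : ℚ) := e.comp ιe.symm.toAddMonoidHom
  have hΛ : ∀ x : AddCircle (1 : ℚ), p • x = 0 → Λ (ι (ψ x)) = x := fun x hx => by
    change e (ιe.symm (ι (ψ x))) = x
    rw [← hιe, AddEquiv.symm_apply_apply, hψ x hx]
  refine ⟨Λ ∘ b, hb_lc.comp Λ, fun σ => ?_, fun σ τ => ?_⟩
  · change p • e (ιe.symm (b σ)) = 0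
    exact hep _
  · have h := hb σ τ
    rw [htriv] at h
    change toMu i (σ, τ) - toMu j (σ, τ) = b τ - b (σ * τ) + b σ at h
    rw [htoMu, htoMu] at h
    have h' := congrArg Λ h
    rw [map_sub, map_add, map_sub, hΛ _ (hpf i σ τ), hΛ _ (hpf j σ τ)] at h'
    rw [h']
    simp only [Function.comp_apply]
    abel

end Pigeonhole

end Literature.NumberTheory.GaloisRepresentations

end
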